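import Summits.QuantumFields.YangMills.Theorems.MirrorModularBoostsSoftKernelBoostCovarianceHilbertVitali
import Summits.QuantumFields.YangMills.Theorems.MirrorModularBoostsSoftKernelBoostCovarianceAsmSuperpositionTools

/-!
# Assembly piece (A1) — heights + Vitali

Line `Sketch` of crux `MirrorModularBoosts.SoftKernelBoostCovariance` (stmt-QuantumFields-14999): a piece of the lead's
assembly (T7) of the registered skeleton `Cruxes/SoftKernelBoostCovariance/Lines/Sketch.lean` (v3.5), pure functional
analysis.  The operator chains of the line produce, for the `k`-th bump-tensor approximant of a test function, ONE
holomorphic family per HEIGHT `m ≤ k` (reserves `≍ e^{-m}`), on the rectangle `{|Re ζ| < ε, |Im ζ| < m}`, all with the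
same real values `g k` and bounded by `K e^{N m}` on their rectangle.  This file turns that datum into ONE holomorphic
family on the strip `{|Re ζ| < ε}` of exponential type `N` with the limiting real values `g'`:

* on the rectangle of height `k`, `V k k = V k m` for `m = ⌊|Im ζ|⌋ + 1 ≤ k` (identity theorem on a rectangle,
  `eqOn_rect_of_eq_real`, landed in …AsmSuperpositionTools), whence `‖V k k ζ‖ ≤ K e^{N m} ≤ K e^{N} e^{N |Im ζ|}`;
* Vitali for Hilbert-valued families on growing rectangles (`stub_hilbertVitali`, landed in …HilbertVitali).

Exported: `stub_asmHeightsVitali` (registered statement, proved here).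
-/

noncomputable section

namespace Summit.QuantumFields.YangMills.Theorems.SoftKernelBoostCovariance.Sketch

open Filter Topology

/-- **Stub (A1) — HEIGHTS + VITALI.**  Families `V k m` (`m ≤ k`) holomorphic on the rectangles
`{|Re ζ| < ε, |Im ζ| < m}`, with common real values `g k` and bounds `K e^{N m}`, whose real values converge pointwise
to `g'`, yield `W` holomorphic on the strip `{|Re ζ| < ε}` with `‖W ζ‖ ≤ K e^{N} e^{N |Im ζ|}` and real values `g'`. -/
theorem stub_asmHeightsVitali :
    ∀ (H : Type) [NormedAddCommGroup H] [InnerProductSpace ℂ H] [CompleteSpace H] (ε K N : ℝ), 0 < ε → 0 ≤ K → 0 ≤ N →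
      ∀ (V : ℕ → ℕ → ℂ → H) (g : ℕ → ℝ → H) (g' : ℝ → H),
        (∀ k m : ℕ, m ≤ k → DifferentiableOn ℂ (V k m) {ζ : ℂ | |ζ.re| < ε ∧ |ζ.im| < (m : ℝ)}) →
        (∀ k m : ℕ, m ≤ k → ∀ ζ : ℂ, |ζ.re| < ε → |ζ.im| < (m : ℝ) → ‖V k m ζ‖ ≤ K * Real.exp (N * m)) →
        (∀ k m : ℕ, m ≤ k → ∀ θ : ℝ, |θ| < ε → V k m θ = g k θ) →
        (∀ θ : ℝ, |θ| < ε → Filter.Tendsto (fun k => g k θ) Filter.atTop (nhds (g' θ))) →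
        ∃ W : ℂ → H, DifferentiableOn ℂ W {ζ : ℂ | |ζ.re| < ε} ∧
          (∀ ζ : ℂ, |ζ.re| < ε → ‖W ζ‖ ≤ K * Real.exp N * Real.exp (N * |ζ.im|)) ∧
          ∀ θ : ℝ, |θ| < ε → W θ = g' θ := by
  intro H _ _ _ ε K N hε hK hN V g g' hdiff hbd hreal hconv
  -- the diagonal families `V k k` are uniformly of type `N` on their rectangles
  have key : ∀ (k : ℕ) (ζ : ℂ), |ζ.re| < ε → |ζ.im| < (k : ℝ) →
      ‖V k k ζ‖ ≤ K * Real.exp N * Real.exp (N * |ζ.im|) := by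
    intro k ζ hre him
    set m : ℕ := ⌊|ζ.im|⌋₊ + 1 with hm_def
    have hfl : (⌊|ζ.im|⌋₊ : ℝ) ≤ |ζ.im| := Nat.floor_le (abs_nonneg _)
    have hmk : m ≤ k := by
      have h1 : ⌊|ζ.im|⌋₊ < k := (Nat.floor_lt (abs_nonneg _)).2 him
      omega
    have hζm : |ζ.im| < (m : ℝ) := by
      rw [hm_def]; push_cast; exact Nat.lt_floor_add_one _
    have hm1 : (m : ℝ) ≤ |ζ.im| + 1 := by rw [hm_def]; push_cast; linarith
    have hEq : Set.EqOn (V k k) (V k m) {z : ℂ | |z.re| < ε ∧ |z.im| < (m : ℝ)} := by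
      refine eqOn_rect_of_eq_real hε (by positivity) ?_ (hdiff k m hmk) ?_
      · exact (hdiff k k le_rfl).mono fun z hz => ⟨hz.1, hz.2.trans_le (by exact_mod_cast hmk)⟩
      · intro θ hθ
        rw [hreal k k le_rfl θ hθ, hreal k m hmk θ hθ]
    rw [hEq ⟨hre, hζm⟩]
    calc ‖V k m ζ‖ ≤ K * Real.exp (N * m) := hbd k m hmk ζ hre hζm
      _ ≤ K * Real.exp N * Real.exp (N * |ζ.im|) := by
          rw [mul_assoc, ← Real.exp_add]
          refine mul_le_mul_of_nonneg_left (Real.exp_le_exp.2 ?_) hK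
          nlinarith [abs_nonneg ζ.im]
  have hconv' : ∀ θ : ℝ, |θ| < ε → Tendsto (fun k => V k k θ) atTop (𝓝 (g' θ)) := fun θ hθ =>
    (hconv θ hθ).congr' (Eventually.of_forall fun k => (hreal k k le_rfl θ hθ).symm)
  obtain ⟨W, hWd, hWb, hWr⟩ := stub_hilbertVitali H ε (K * Real.exp N) N hε (fun k => V k k) g'
    (fun k => hdiff k k le_rfl) key hconv'
  exact ⟨W, hWd, hWb, hWr⟩

end Summit.QuantumFields.YangMills.Theorems.SoftKernelBoostCovariance.Sketch

end
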